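import Literature.Topology.FourManifolds.TrisectionFunctorGKInputs
import Literature.Topology.FourManifolds.TrisectionFunctorGKVanKampen
import Literature.Topology.FourManifolds.TrisectionFunctorGKCentralSurface
import Literature.Topology.FourManifolds.ProfiniteDetectionSumS1S2
import HarnessLib

/-!
# A `(g; k₁, k₂, k₃)`-trisection has `kᵢ ≤ g`

Topic `Literature/Topology/FourManifolds`.  For a Gay–Kirby trisection (with corners along the
central surface, `Literature.Topology.FourManifolds.IsGKTrisection X g k S`) each sector `X_l` is a
`4`-dimensional `1`-handlebody with `k l` one-handles whose boundary `∂X_l = H ∪_F H′` is Heegaard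
split by two genus-`g` handlebodies; hence `π₁(H) ≅ F_g` surjects onto
`π₁(∂X_l) ≅ π₁(X_l) ≅ F_{k_l}` and **`k l ≤ g`** (Gay–Kirby 2016, Def. 1 with "`0 ≤ k ≤ g`" in
Thm. 4; Meier–Schirmer–Zupan 2016, Def. 1.1: `∂X_i ≅ #^{k_i}(S¹ × S²)` has Heegaard genus `k_i`,
so a genus-`g` splitting needs `g ≥ k_i`).  This inequality is tacit throughout the trisection
literature (e.g. in the induction of MSZ's Thm. 1.2, where the hypothesis `k₁ ≥ g − 1` must pass
to the pieces of a connected sum `(g; k) = (g′; k′) # (g″; k″)`; see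
`LargeKTrisectionClassificationProofs.lean`, `msz_conclusion_of_splitting`).  Everything here is
PROVED from the tree's `π₁` computations for trisections:

* `Literature.Topology.FourManifolds.IsFreeOfRank.le_of_surjective` — **a free group of rank `n`
  which is a quotient of a free group of rank `m` has `n ≤ m`** (test on the elementary abelian
  `2`-group `(ℤ/2)ⁿ`: `exists_surjective_freeGroup_elementaryTwo`,
  `le_of_surjective_freeGroup_elementaryTwo` of `ProfiniteDetectionSumS1S2.lean`).
* `Literature.Topology.FourManifolds.IsGKTrisection.le_genus` — **`k l ≤ g`**: the inclusion
  `H_{l+1} = S (l + 2) ∩ S l ⊆ ∂X_l = S l ∩ (S (l + 1) ∪ S (l + 2))` induces a surjection on `π₁`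
  (because `π₁(F) → π₁(∂X_l)` is onto, `IsGKTrisection.surjective_and_ker_eq_sectorBoundary`, and
  factors through `π₁(H_{l+1})`, `inclHomOfSubset_comp`), between free groups of ranks `g`
  (`IsGKTrisection.isFreeOfRank_fundamentalGroup_handlebody`) and `k l`
  (`IsGKTrisection.isFreeOfRank_fundamentalGroup_sectorBoundary`).
* `Literature.Topology.FourManifolds.IsGKTrisection.sum_le` — `k 0 + k 1 + k 2 ≤ 3 g`.

## References

* D. Gay, R. Kirby, *Trisecting 4-manifolds*, Geom. Topol. 20 (2016) 3097–3132, Def. 1, Thm. 4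
  ("for some `0 ≤ k ≤ g`"). [GayKirby2016]
* J. Meier, T. Schirmer, A. Zupan, *Classification of trisections and the Generalized Property R
  Conjecture*, Proc. AMS 144 (2016), Def. 1.1 and §2. [MeierSchirmerZupan2016]
* A. Abrams, D. Gay, R. Kirby, *Group trisections and smooth 4-manifolds*, Geom. Topol. 22
  (2018), p. 1540 (`π₁(H_{ij}) ≅ F_g`, `π₁(∂X_i) ≅ F_k`). [AbramsGayKirby2018]
-/

noncomputable section

open Set Function Filter Topology
open scoped Manifold ContDiff

namespace Literature.Topology.FourManifolds

open Literature.AlgebraicTopology Literature.AlgebraicTopology.FundamentalGroup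
  Literature.AlgebraicTopology.FundamentalGroup.VanKampen

universe u

/-! ### Ranks of free groups under surjections -/

/-- **A free group of rank `n` onto which a free group of rank `m` surjects has `n ≤ m`**: compose
with `F_n ↠ (ℤ/2)ⁿ` (`exists_surjective_freeGroup_elementaryTwo`) and count
(`le_of_surjective_freeGroup_elementaryTwo`; equivalently, abelianise and compare ranks).
[folklore] -/
theorem IsFreeOfRank.le_of_surjective {G H : Type*} [Group G] [Group H] {m n : ℕ}
    (hG : IsFreeOfRank G m) (hH : IsFreeOfRank H n) (f : G →* H) (hf : Function.Surjective f) :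
    n ≤ m := by
  obtain ⟨eG⟩ := hG
  obtain ⟨eH⟩ := hH
  obtain ⟨p, hp⟩ := exists_surjective_freeGroup_elementaryTwo n
  exact le_of_surjective_freeGroup_elementaryTwo
    ((p.comp eH.symm.toMonoidHom).comp (f.comp eG.toMonoidHom))
    (hp.comp (eH.symm.surjective.comp (hf.comp eG.surjective)))

/-! ### `kᵢ ≤ g` -/

section LeGenus

variable {X : Type u} [TopologicalSpace X] [T2Space X] [SecondCountableTopology X]
  [ChartedSpace (EuclideanSpace ℝ (Fin 4)) X] {g : ℕ} {k : Fin 3 → ℕ} {S : Fin 3 → Set X}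

/-- **Each sector of a `(g; k₁, k₂, k₃)`-trisection has at most `g` one-handles: `k l ≤ g`.**
The handlebody `H_{l+1} = S (l + 2) ∩ S l` lies in the boundary `∂X_l = S l ∩ (S (l+1) ∪ S (l+2))`
of the sector `X_l`; at a base point of the central surface `F`, `π₁(F) → π₁(∂X_l)` is onto
(`IsGKTrisection.surjective_and_ker_eq_sectorBoundary`, van Kampen for the Heegaard splitting
`∂X_l = H ∪_F H′`) and factors through `π₁(H_{l+1})` (`inclHomOfSubset_comp`), so
`π₁(H_{l+1}) ≅ F_g` (`IsGKTrisection.isFreeOfRank_fundamentalGroup_handlebody`) surjects onto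
`π₁(∂X_l) ≅ F_{k_l}` (`IsGKTrisection.isFreeOfRank_fundamentalGroup_sectorBoundary`), whence
`k l ≤ g` (`IsFreeOfRank.le_of_surjective`).  (Gay–Kirby 2016, Def. 1 / Thm. 4 "`0 ≤ k ≤ g`";
MSZ 2016, Def. 1.1: a genus-`g` Heegaard splitting of `∂X_i ≅ #^{k_i}(S¹ × S²)`.)
[cite: GayKirby2016, Def. 1 and Thm. 4] [cite: MeierSchirmerZupan2016, Def. 1.1]
[cite: AbramsGayKirby2018, p. 1540 (π₁(H_ij) ≅ F_g, π₁(∂X_i) ≅ F_k)] -/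
theorem IsGKTrisection.le_genus (h : IsGKTrisection X g k S) (l : Fin 3) : k l ≤ g := by
  obtain ⟨x, hx⟩ := h.nonempty_iInter
  obtain ⟨e1, e2, -, -⟩ := fin3_add l
  -- `H_{l+1} = S (l+1+1) ∩ S (l+1+2) = S (l+2) ∩ S l ⊆ ∂X_l`
  have hsub : S (l + 1 + 1) ∩ S (l + 1 + 2) ⊆ S l ∩ (S (l + 1) ∪ S (l + 2)) := by
    rw [e1, e2]
    intro y hy
    exact ⟨hy.2, Or.inr hy.1⟩
  have hxH : x ∈ S (l + 1 + 1) ∩ S (l + 1 + 2) := iInter_subset_inter S (l + 1) hx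
  have hxB : x ∈ S l ∩ (S (l + 1) ∪ S (l + 2)) := iInter_subset_sectorBoundary S l hx
  -- `π₁(F) ↠ π₁(∂X_l)` factors through `π₁(H_{l+1})`
  have hsurj := (h.surjective_and_ker_eq_sectorBoundary l hx).1
  have hcomp := inclHomOfSubset_comp (iInter_subset_inter S (l + 1)) hsub hx hxH hxB
  have hsurjH : Function.Surjective (inclHomOfSubset hsub x hxH hxB) := by
    refine Function.Surjective.of_comp (g := inclHomOfSubset (iInter_subset_inter S (l + 1)) x hx hxH) ?_
    have hc : ((inclHomOfSubset hsub x hxH hxB).comp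
        (inclHomOfSubset (iInter_subset_inter S (l + 1)) x hx hxH) : _ → _) =
        inclHomOfSubset (iInter_subset_sectorBoundary S l) x hx hxB := by
      rw [hcomp]
    rw [← MonoidHom.coe_comp, hc]
    exact hsurj
  -- ranks: `F_g ↠ F_{k l}`
  exact (h.isFreeOfRank_fundamentalGroup_handlebody (l + 1) hx).le_of_surjective
    (h.isFreeOfRank_fundamentalGroup_sectorBoundary l hxB) _ hsurjH

/-- **`k₁ + k₂ + k₃ ≤ 3g`** for a `(g; k₁, k₂, k₃)`-trisection (sum of `IsGKTrisection.le_genus`).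
[cite: GayKirby2016, Def. 1 and Thm. 4] -/
theorem IsGKTrisection.sum_le (h : IsGKTrisection X g k S) : k 0 + k 1 + k 2 ≤ 3 * g := by
  have h0 := h.le_genus 0
  have h1 := h.le_genus 1
  have h2 := h.le_genus 2
  omega

end LeGenus

end Literature.Topology.FourManifolds

end
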